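import Mathlib
import HarnessLib
import Summits.NavierStokesRegularity.NavierStokesRegularity.Theorems.UnthreadedDoorCapSymZonalToroidalStructure

/-!
# Route `UnthreadedDoor`, crux `PoloidalLiouville` (stmt-NavierStokesRegularity-1222), WALL W1 `stub_scalarLiouville` —
# crux idea «capsym-comparison» (ns-idea-13 g0), line input FL-C `CapSym.ZonalToroidalLiouville`: THE SCALAR EQUATION (KNSS (5.10))

KEY-NS #150 (2) / DIRECTOR-NS #246 (4), the junction of steps (1)–(3) of the FL-C handoff plan (`FLC-HANDOFF.md`, evidence on 1222)
with step (4): the induction equation for `B = ∇U × x` (p654669 `CapSym.inductionEquation_of_potentialForm`), the structure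
`B = f · J` (p651633) and the transport identity (p651633) give, paired with `Jx`, KNSS's scalar equation (5.10) for
`f = B_φ/ϖ = hadamardQuotFst (B ·)₁` with the GIVEN drift `V`:
`⟪∂ₜB, Jx⟫ = ϖ² (Δf − Df[V]) + 2 (x₀∂₀f + x₁∂₁f)`, `ϖ² = x₀² + x₁²`
— stated with the time derivative `∂ₜB(t,x)` as a free vector `Bt` satisfying the induction equation at `x`, so that the successor
only has to supply `⟪∂ₜB, Jx⟫ = ϖ² ∂ₜf` (joint regularity of the Hadamard quotient, the pattern of
`KNSSThm52Assembly.scalar_family_regularity`) before the `ℝ⁵` lift.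

* `CapSym.inner_rotGen_eq_of_inductionEq` — the pairing for any `B = f · J`, `f ∈ C²`, drift with `DV(x)[Jx] = J V(x)`;
* `CapSym.scalarEq_cross_gradient_of_inductionEq` — the case `B = ∇U × x`, `U ∈ C⁴` axisymmetric, `V` axisymmetric and
  differentiable, `f = hadamardQuotFst (fun y => cross (gradient U y) y 1)`.

WHAT THIS IS NOT: no NS-regularity statement is touched; FL-C is NOT proved here (remaining: `⟪∂ₜB, Jx⟫ = ϖ² ∂ₜf`, the `ℝ⁵` lift and
`KNSSMaxPrincipleR5` — `FLC-HANDOFF.md`); `PoloidalLiouville` (1222), its wall and the summit stay OPEN.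
`--supports stmt-NavierStokesRegularity-1222 --as helper`.  [cite: KochNadirashviliSereginSverak2009, §5 (5.10) p. 97]
-/

noncomputable section

-- the summit and its single sub-problem share the name (CONVENTIONS §1)
set_option linter.dupNamespace false

open Set Function Filter Topology InnerProductSpace
open scoped RealInnerProductSpace Laplacian ContDiff

namespace Summit.NavierStokesRegularity.NavierStokesRegularity.Theorems.PoloidalLiouville.CapSym

open Literature.Analysis Literature.Analysis.FluidPDE

/-- **KNSS (5.10) from the induction equation, for any `B = f · J`.**  If `Bt + DB(x)[V x] − DV(x)[B x] = ΔB(x)` (the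
induction equation at `x`, `Bt` standing for `∂ₜB(t,x)`), `f ∈ C²` and `DV(x)[Jx] = J V(x)`, then
`⟪Bt, Jx⟫ = ϖ²(Δf − Df[V x]) + 2(x₀∂₀f + x₁∂₁f)`. [cite: KochNadirashviliSereginSverak2009, §5 (5.10) p. 97] -/
theorem inner_rotGen_eq_of_inductionEq {V B : EuclideanSpace ℝ (Fin 3) → EuclideanSpace ℝ (Fin 3)}
    {f : EuclideanSpace ℝ (Fin 3) → ℝ} (hf : ContDiff ℝ 2 f) (hB : B = fun y => f y • rotGen y)
    {x : EuclideanSpace ℝ (Fin 3)} (hax : fderiv ℝ V x (rotGen x) = rotGen (V x)) {Bt : EuclideanSpace ℝ (Fin 3)}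
    (hind : Bt + fderiv ℝ B x (V x) - fderiv ℝ V x (B x) = (Δ B) x) :
    ⟪Bt, rotGen x⟫ =
      (x 0 ^ 2 + x 1 ^ 2) * ((Δ f) x - fderiv ℝ f x (V x)) +
        2 * (x 0 * fderiv ℝ f x (EuclideanSpace.single 0 1) + x 1 * fderiv ℝ f x (EuclideanSpace.single 1 1)) := by
  have e : Bt = (Δ B) x - fderiv ℝ B x (V x) + fderiv ℝ V x (B x) := by
    rw [← hind]; abel
  rw [e]
  exact inner_transport_terms_rotGen_eq hf hB hax

/-- **KNSS (5.10) for the toroidal field of a zonal potential.**  For `U ∈ C⁴(ℝ³)` axisymmetric about `e₂`, `V` differentiable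
and axisymmetric, and `Bt + D(∇U × ·)(x)[V x] − DV(x)[∇U(x) × x] = Δ(∇U × ·)(x)` (the induction equation at `x`, p654669),
the Hadamard quotient `f = hadamardQuotFst ((∇U × ·) ·)₁` (`= B_φ/ϖ`) satisfies
`⟪Bt, Jx⟫ = ϖ²(Δf − Df[V x]) + 2(x₀∂₀f + x₁∂₁f)`. [cite: KochNadirashviliSereginSverak2009, §5 (5.10) p. 97, Thm 5.2] -/
theorem scalarEq_cross_gradient_of_inductionEq {V : EuclideanSpace ℝ (Fin 3) → EuclideanSpace ℝ (Fin 3)}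
    {U : EuclideanSpace ℝ (Fin 3) → ℝ} (hU : ContDiff ℝ 4 U) (haxU : IsAxisymmetricScalar U)
    (hV : Differentiable ℝ V) (haxV : IsAxisymmetric V) {x Bt : EuclideanSpace ℝ (Fin 3)}
    (hind : Bt + fderiv ℝ (fun y : EuclideanSpace ℝ (Fin 3) => cross (gradient U y) y) x (V x)
      - fderiv ℝ V x (cross (gradient U x) x) = (Δ (fun y : EuclideanSpace ℝ (Fin 3) => cross (gradient U y) y)) x) :
    ⟪Bt, rotGen x⟫ =
      (x 0 ^ 2 + x 1 ^ 2) *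
          ((Δ (hadamardQuotFst fun y : EuclideanSpace ℝ (Fin 3) => cross (gradient U y) y 1)) x -
            fderiv ℝ (hadamardQuotFst fun y : EuclideanSpace ℝ (Fin 3) => cross (gradient U y) y 1) x (V x)) +
        2 * (x 0 * fderiv ℝ (hadamardQuotFst fun y : EuclideanSpace ℝ (Fin 3) => cross (gradient U y) y 1) x
              (EuclideanSpace.single 0 1) +
          x 1 * fderiv ℝ (hadamardQuotFst fun y : EuclideanSpace ℝ (Fin 3) => cross (gradient U y) y 1) x
              (EuclideanSpace.single 1 1)) := by
  have hf : ContDiff ℝ 2 (hadamardQuotFst fun y : EuclideanSpace ℝ (Fin 3) => cross (gradient U y) y 1) :=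
    contDiff_hadamardQuotFst_cross_gradient (n := 2) (by exact_mod_cast hU)
  have hB : (fun y : EuclideanSpace ℝ (Fin 3) => cross (gradient U y) y) =
      fun y => (hadamardQuotFst fun z : EuclideanSpace ℝ (Fin 3) => cross (gradient U z) z 1) y • rotGen y :=
    funext fun y => cross_gradient_eq_hadamardQuotFst_smul_rotGen (hU.of_le (by norm_cast)) haxU y
  have hax : fderiv ℝ V x (rotGen x) = rotGen (V x) := haxV.fderiv_rotGen (hV x)
  exact inner_rotGen_eq_of_inductionEq hf hB hax hind

end Summit.NavierStokesRegularity.NavierStokesRegularity.Theorems.PoloidalLiouville.CapSym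

end
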